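import Literature.NumberTheory.EllipticCurves.PAdicLFunctionQuadraticTwistBirchProofs
import Literature.NumberTheory.EllipticCurves.RootNumberTwistProofs
import Literature.NumberTheory.EllipticCurves.RootNumberSmulProofs
import Literature.NumberTheory.EllipticCurves.QuadraticTwistMinimalModelProofs
import Literature.NumberTheory.DiophantineGeometry.LocalReductionHasAdditiveReductionAtProofs
import HarnessLib

/-!
# Birch's lemma for the `p`-adic `L`-function of a quadratic twist `E^{(d)}` when `d` MEETS the conductor at
# multiplicative primes: `aₙ(E^{(d)}) = χ_d(n)aₙ(E)`, `N_E ∣ N_{E^{(d)}}`, `d² ∣ N_{E^{(d)}}`, and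
# `L_p(f_{E^{(d)}}, α', T) = C(c)·(1+T)^{−f_m}·L_p(f_E, m, α, χ_d, T)` (PROOFS ONLY)

Companion of `PAdicLFunctionQuadraticTwistBirchProofs` (cell bsd-2adic, seat conv-1 GEN 16), which assumes
`(d, N_E) = 1`. Here `d > 0`, `d ≡ 1 (mod 4)` square-free, and at every prime `ℓ ∣ d` the curve `E = W/ℚ` (globally
minimal) has GOOD OR MULTIPLICATIVE reduction (`hred`); `A/ℚ` is a globally minimal model of `W^{(d)}`.

* §1 `hasAdditiveReductionAt_quadraticTwist_of_dvd_of_hasMultiplicativeReductionAt` — twisting a curve with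
  MULTIPLICATIVE reduction at an odd place `v` by a character ramified at `v` (`ℓ_v ∥ d`) makes the reduction additive: the
  twisted equation is `v`-integral with `v(c₄) = v(d²c₄(W)) = 2 < 4` (so minimal) and `v(Δ) = 6 + v(Δ_W) > 0`
  (Silverman VII.1 Rem. 1.1, VII.5 Prop. 5.1(c); the good case is the tree's `hasAdditiveReductionAt_quadraticTwist_of_dvd`).
* §2 `LFunction_quadraticTwist_apply_of_isGloballyMinimal_sqfreeAt` — **`aₙ(E^{(d)}) = (n/|d|)·aₙ(E)` for all `n`**
  under `hred` (the tree's `LFunction_quadraticTwist_apply_of_isGloballyMinimal` verbatim, the additive reduction of the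
  twist at `ℓ ∣ d` now coming from §1 at the multiplicative primes).
* §3 conductor bookkeeping (`factorization_conductorNorm_quadraticTwist_eq_of_not_dvd`, `…_of_dvd`,
  `conductorNorm_dvd_and_sq_dvd_conductorNorm_quadraticTwist`): at `q ∤ d` the conductor exponents of `E` and `E^{(d)}`
  agree (`conductorExponent_twistModel`, the twist being `E`'s `twistModel ((d−1)/4)` up to isomorphism); at `q ∣ d`,
  `f_q(E) ≤ 1 < 2 ≤ f_q(E^{(d)})`; hence `N_E ∣ N_{E^{(d)}}`, `d² ∣ N_{E^{(d)}}`, and `2 ∤ N_E ⇒ 2 ∤ N_{E^{(d)}}`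
  (the exact `N_{E^{(d)}} = N_E d²/gcd(d, N_E)` is not needed).
* §4 Birch's lemma as in the coprime file: `LFunction_twist_apply_sqfreeAt`, `isNewformOf_twist_eq_charTwist_sqfreeAt`
  (the newform of `A` IS Shimura's twisted form at level `N_A`, for which `N_W ∣ N_A` and `d² ∣ N_A` suffice),
  `exists_ratPlusSymbol_twist_eq_sum_sqfreeAt`, `isOrdinaryAt_twist_and_unitRoot_eq_sqfreeAt`,
  **`exists_padicLFunction_twist_eq_C_mul_padicLFunctionTame_sqfreeAt`**.

References: B. Mazur, J. Tate, J. Teitelbaum, Invent. Math. 84 (1986), §I.8, §I.11–I.13 [MazurTateTeitelbaum1986Invent];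
G. Shimura (1971), Prop. 3.64 [Shimura1971]; A. O. L. Atkin, J. Lehner, Math. Ann. 185 (1970), §6 [AtkinLehner1970];
J. H. Silverman, *AEC* (2009), VII.1 Rem. 1.1, VII.5 Prop. 5.1, X.2, App. C §16 [SilvermanAEC2009].
-/

noncomputable section

open scoped Classical MatrixGroups ModularForm NumberTheorySymbols

open CongruenceSubgroup NumberField IsDedekindDomain IsDedekindDomain.HeightOneSpectrum Rat.HeightOneSpectrum
  WeierstrassCurve PowerSeries Literature.NumberTheory.EllipticCurves.ModularForms
  Literature.NumberTheory.EllipticCurves.GreenbergVatsal2000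

namespace WeierstrassCurve

/-! ### §1. Twisting a multiplicative curve by a ramified character gives additive reduction -/

section Ramified

variable (W : WeierstrassCurve ℚ) [W.IsElliptic]

/-- **Twisting a curve of MULTIPLICATIVE reduction by a ramified character makes the reduction additive** (odd residue
characteristic). Let `W / ℚ` be a global minimal model with multiplicative reduction at the place `v` over an odd prime
`ℓ`, and `D` an integer with `ℓ ∥ D`. Then `W^{(D)} : y² = x³ + (D b₂/4) x² + (D² b₄/2) x + D³ b₆/4` has additive
reduction at `v`: the equation is `v`-integral, `v(c₄) = v(D²c₄(W)) = 2 < 4` (so it is minimal, Silverman VII.1 Rem. 1.1)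
and `v(c₄) > 0`, `v(Δ) = 6 + v(Δ_W) > 0` (VII.5 Prop. 5.1(c); `hasAdditiveReductionAt_of_lt_valuation_c₄`). The
multiplicative companion of `hasAdditiveReductionAt_quadraticTwist_of_dvd`.
[cite: SilvermanAEC2009, VII.1 Remark 1.1 and VII.5 Prop. 5.1(c)] -/
theorem hasAdditiveReductionAt_quadraticTwist_of_dvd_of_hasMultiplicativeReductionAt [W.IsGloballyMinimal]
    (v : HeightOneSpectrum (𝓞 ℚ)) (hv2 : (primesEquiv v : ℕ) ≠ 2) {D : ℤ} (hD0 : D ≠ 0)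
    (h1 : ((primesEquiv v : ℕ) : ℤ) ∣ D) (h2 : ¬ ((primesEquiv v : ℕ) : ℤ) ^ 2 ∣ D)
    (hmult : W.HasMultiplicativeReductionAt v) : (W.quadraticTwist (D : ℚ)).HasAdditiveReductionAt v := by
  have hpP : (primesEquiv v : ℕ).Prime := (primesEquiv v).2
  have hpZ : Prime ((primesEquiv v : ℕ) : ℤ) := Nat.prime_iff_prime_int.mp hpP
  have hp2 : ¬ ((primesEquiv v : ℕ) : ℤ) ∣ 2 := fun h ↦
    hv2 ((Nat.prime_dvd_prime_iff_eq hpP Nat.prime_two).mp (Int.natCast_dvd_natCast.mp h))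
  have hp4 : ¬ ((primesEquiv v : ℕ) : ℤ) ∣ 4 := fun h ↦
    (hpZ.dvd_or_dvd (show ((primesEquiv v : ℕ) : ℤ) ∣ 2 * 2 by norm_num; exact h)).elim hp2 hp2
  have hDq : (D : ℚ) ≠ 0 := by exact_mod_cast hD0
  haveI := W.isElliptic_quadraticTwist hDq
  set M : WeierstrassCurve ℤ := integralModelInt W with hM
  have hWM : M.map (Int.castRingHom ℚ) = W := map_integralModelInt W
  have hWb₂ : W.b₂ = (M.b₂ : ℚ) := by rw [← congrArg WeierstrassCurve.b₂ hWM, map_b₂, eq_intCast]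
  have hWb₄ : W.b₄ = (M.b₄ : ℚ) := by rw [← congrArg WeierstrassCurve.b₄ hWM, map_b₄, eq_intCast]
  have hWb₆ : W.b₆ = (M.b₆ : ℚ) := by rw [← congrArg WeierstrassCurve.b₆ hWM, map_b₆, eq_intCast]
  have hv4 : v.valuation ℚ (4 : ℚ) = 1 := by
    have h := valuation_ringOfIntegers_intCast_eq_one v (n := 4) (by exact_mod_cast hp4)
    simpa using h
  have hv2' : v.valuation ℚ (2 : ℚ) = 1 := by
    have h := valuation_ringOfIntegers_intCast_eq_one v (n := 2) (by exact_mod_cast hp2)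
    simpa using h
  have hvD : v.valuation ℚ (D : ℚ) = WithZero.exp (-1 : ℤ) :=
    valuation_ringOfIntegers_intCast_eq_exp_neg_one v h1 h2
  obtain ⟨hvΔ, hvc₄⟩ :=
    (hasMultiplicativeReductionAt_iff_of_isMinimalAt (v := v) (W := W) (IsGloballyMinimal.isMinimal v)).mp hmult
  have hvb₂ : v.valuation ℚ W.b₂ ≤ 1 := hWb₂ ▸ valuation_ringOfIntegers_intCast_le_one v _
  have hvb₄ : v.valuation ℚ W.b₄ ≤ 1 := hWb₄ ▸ valuation_ringOfIntegers_intCast_le_one v _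
  have hvb₆ : v.valuation ℚ W.b₆ ≤ 1 := hWb₆ ▸ valuation_ringOfIntegers_intCast_le_one v _
  have he1 : WithZero.exp (-1 : ℤ) ≤ 1 := by
    rw [← WithZero.exp_zero]; exact WithZero.exp_le_exp.mpr (by norm_num)
  -- the twist equation is `v`-integral
  have hint : (W.quadraticTwist (D : ℚ)).IsIntegralAt v := by
    refine (W.quadraticTwist (D : ℚ)).isIntegralAt_of_valuation_le_one v ?_ ?_ ?_ ?_ ?_
    · simp
    · simp only [quadraticTwist_a₂, map_div₀, map_mul, hv4, hvD, div_one]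
      exact mul_le_one' he1 hvb₂
    · simp
    · simp only [quadraticTwist_a₄, map_div₀, map_mul, map_pow, hv2', hvD, div_one]
      exact mul_le_one' (pow_le_one' he1 2) hvb₄
    · simp only [quadraticTwist_a₆, map_div₀, map_mul, map_pow, hv4, hvD, div_one]
      exact mul_le_one' (pow_le_one' he1 3) hvb₆
  -- `v(c₄) = 2`: `exp(−4) < v(c₄) < 1`, and `v(Δ) = exp(−6)·v(Δ_W) < 1`
  have hc₄ : v.valuation ℚ (W.quadraticTwist (D : ℚ)).c₄ = WithZero.exp (-2 : ℤ) := by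
    rw [quadraticTwist_c₄, map_mul, map_pow, hvD, hvc₄, mul_one, ← WithZero.exp_nsmul]
    norm_num
  refine hasAdditiveReductionAt_of_lt_valuation_c₄ hint ?_ ?_ ?_
  · rw [hc₄]; exact WithZero.exp_lt_exp.mpr (by norm_num)
  · rw [hc₄, ← WithZero.exp_zero]; exact WithZero.exp_lt_exp.mpr (by norm_num)
  · rw [quadraticTwist_Δ, map_mul, map_pow, hvD, ← WithZero.exp_nsmul]
    have he6 : WithZero.exp (6 • (-1 : ℤ)) ≤ 1 := by
      rw [← WithZero.exp_zero]; exact WithZero.exp_le_exp.mpr (by norm_num)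
    calc WithZero.exp (6 • (-1 : ℤ)) * v.valuation ℚ W.Δ ≤ v.valuation ℚ W.Δ := mul_le_of_le_one_left' he6
      _ < 1 := hvΔ

/-- **At a prime `ℓ ∥ D` where `E` is good OR multiplicative, `E^{(D)}` is additive** (the two cases
`hasAdditiveReductionAt_quadraticTwist_of_dvd`, `…_of_hasMultiplicativeReductionAt`).
[cite: SilvermanAEC2009, VII.5 Prop. 5.1(c)] -/
theorem hasAdditiveReductionAt_quadraticTwist_of_dvd_of_good_or_mult [W.IsGloballyMinimal]
    (v : HeightOneSpectrum (𝓞 ℚ)) (hv2 : (primesEquiv v : ℕ) ≠ 2) {D : ℤ} (hD0 : D ≠ 0)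
    (h1 : ((primesEquiv v : ℕ) : ℤ) ∣ D) (h2 : ¬ ((primesEquiv v : ℕ) : ℤ) ^ 2 ∣ D)
    (hred : W.HasGoodReductionAt v ∨ W.HasMultiplicativeReductionAt v) :
    (W.quadraticTwist (D : ℚ)).HasAdditiveReductionAt v := by
  rcases hred with hg | hm
  · exact W.hasAdditiveReductionAt_quadraticTwist_of_dvd v hv2 hD0 h1 h2 hg
  · exact W.hasAdditiveReductionAt_quadraticTwist_of_dvd_of_hasMultiplicativeReductionAt v hv2 hD0 h1 h2 hm

end Ramified

/-! ### §2. `aₙ(E^{(D)}) = (n / |D|) aₙ(E)` when `E` is good or multiplicative at the primes of `D` -/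

section Global

variable (W : WeierstrassCurve ℚ) [W.IsElliptic]

/-- **`aₙ(E^{(D)}) = (n / |D|) aₙ(E)` for all `n`**, for a global minimal model `W` of `E`, an odd fundamental discriminant
`D` (`D ≡ 1 (mod 4)` square-free) and GOOD OR MULTIPLICATIVE reduction of `E` at every prime dividing `D` — the tree's
`LFunction_quadraticTwist_apply_of_isGloballyMinimal` with its good-reduction hypothesis at the primes of `D` relaxed:
at a place `v ∣ D` the twist is additive in both cases (§1), so `L_v(E^{(D)}, T) = 1`, matching `χ_D(ℓ) = 0`; the
unramified places are treated exactly as there. [cite: SilvermanAEC2009, X.2 and Exercise 10.16] -/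
theorem LFunction_quadraticTwist_apply_of_isGloballyMinimal_sqfreeAt [W.IsGloballyMinimal] {D : ℤ}
    (hD4 : D % 4 = 1) (hsq : Squarefree D)
    (hred : ∀ v : HeightOneSpectrum (𝓞 ℚ), ((primesEquiv v : ℕ) : ℤ) ∣ D →
      W.HasGoodReductionAt v ∨ W.HasMultiplicativeReductionAt v)
    (n : ℕ) :
    (W.quadraticTwist (D : ℚ)).LFunction n = J((n : ℤ) | D.natAbs) * W.LFunction n := by
  have hD0 : D ≠ 0 := by rintro rfl; norm_num at hD4
  have hDq : (D : ℚ) ≠ 0 := by exact_mod_cast hD0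
  haveI : (W.quadraticTwist (D : ℚ)).IsElliptic := W.isElliptic_quadraticTwist hDq
  rw [LFunction_eq_eulerProduct, LFunction_eq_eulerProduct]
  refine ArithmeticFunction.eulerProduct_apply_eq_mul_of_forall (P := fun _ ↦ True)
    (fun _ _ _ ↦ ⟨trivial, trivial⟩) (fun n : ℕ ↦ J((n : ℤ) | D.natAbs))
    (by exact_mod_cast jacobiSym.one_left D.natAbs)
    (fun m n ↦ by push_cast; exact jacobiSym.mul_left _ _ _) _ _ (fun v m _ ↦ ?_)
    (eventually_cofinite_localEulerFactor_apply _) (eventually_cofinite_localEulerFactor_apply _) trivial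
  haveI := Fact.mk (primesEquiv v).2
  have hℓ1 : 1 < (primesEquiv v : ℕ) := (primesEquiv v).2.one_lt
  by_cases hvD : ((primesEquiv v : ℕ) : ℤ) ∣ D
  · -- ramified place: the factor of the twist is trivial and `χ_D(ℓ) = 0`
    have hv2 : (primesEquiv v : ℕ) ≠ 2 := by
      intro h
      rw [h] at hvD
      have : D % 2 = 0 := Int.emod_eq_zero_of_dvd (by exact_mod_cast hvD)
      omega
    have hsq' : ¬ ((primesEquiv v : ℕ) : ℤ) ^ 2 ∣ D := by
      intro h
      have hu := hsq ((primesEquiv v : ℕ) : ℤ) (by rw [← sq]; exact h)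
      rw [Int.isUnit_iff_natAbs_eq, Int.natAbs_natCast] at hu
      exact (primesEquiv v).2.one_lt.ne' hu
    have hadd := W.hasAdditiveReductionAt_quadraticTwist_of_dvd_of_good_or_mult v hv2 hD0 hvD hsq' (hred v hvD)
    haveI : NeZero D.natAbs := ⟨Int.natAbs_ne_zero.mpr hD0⟩
    have hJ0 : J(((primesEquiv v : ℕ) : ℤ) | D.natAbs) = 0 := by
      rw [jacobiSym.eq_zero_iff_not_coprime, Int.gcd_natCast_natCast]
      intro hcop
      have hdvd : (primesEquiv v : ℕ) ∣ D.natAbs := Int.natCast_dvd.mp hvD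
      exact (primesEquiv v).2.one_lt.ne' (Nat.Coprime.eq_one_of_dvd hcop hdvd)
    rw [localEulerFactor_eq_one_of_hasAdditiveReduction _ hadd, ArithmeticFunction.one_apply]
    split_ifs with hm1
    · rw [hm1, localEulerFactor_apply_one, Nat.cast_one, jacobiSym.one_left, one_mul]
    · by_cases hpow : ∃ k, Nat.card (IsLocalRing.ResidueField (v.adicCompletionIntegers ℚ)) ^ k = m
      · obtain ⟨k, rfl⟩ := hpow
        rw [natCard_residueField_adicCompletionIntegers] at hm1 ⊢
        have hk : k ≠ 0 := fun h ↦ hm1 (by rw [h, pow_zero])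
        rw [Nat.cast_pow, jacobiSym.pow_left, hJ0, zero_pow hk, zero_mul]
      · rw [localEulerFactor_apply_eq_zero _ _ (by rwa [natCard_residueField_adicCompletionIntegers]) hpow,
          mul_zero]
  · -- unramified place
    have key : ((W.quadraticTwist (D : ℚ)).baseChange (v.adicCompletion ℚ)).localEulerFactor
        (v.adicCompletionIntegers ℚ) =
        ArithmeticFunction.ofPowerSeries (primesEquiv v : ℕ)
          (PowerSeries.rescale (J(((primesEquiv v : ℕ) : ℤ) | D.natAbs))
            ((W.baseChange (v.adicCompletion ℚ)).localPowerSeries (v.adicCompletionIntegers ℚ))) := by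
      by_cases hv2 : (primesEquiv v : ℕ) = 2
      · exact W.localEulerFactor_quadraticTwist_two_of_emod_four_eq_one hD4 v hv2
      · exact W.localEulerFactor_quadraticTwist_of_odd_of_not_dvd hD4 v hv2 hvD
    rw [key, localEulerFactor, natCard_residueField_adicCompletionIntegers]
    exact ArithmeticFunction.ofPowerSeries_rescale_apply hℓ1 (fun n : ℕ ↦ J((n : ℤ) | D.natAbs))
      (by exact_mod_cast jacobiSym.one_left D.natAbs)
      (fun m n ↦ by push_cast; exact jacobiSym.mul_left _ _ _) _ m

end Global

/-! ### §3. Conductor bookkeeping: `N_E ∣ N_{E^{(d)}}`, `d² ∣ N_{E^{(d)}}`, `2 ∤ N_{E^{(d)}}` -/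

section Conductor

variable (W : WeierstrassCurve ℚ) [W.IsElliptic]

/-- **At a place `q ∤ d` the conductor exponents of `E` and `E^{(d)}` agree** (`d ≡ 1 (mod 4)`): `E^{(d)}` is, up to a
`ℚ`-isomorphism, the twist model `W.twistModel ((d−1)/4)` (`exists_variableChange_twistModel_eq_quadraticTwist`), whose
conductor exponent at a place where `d` is a unit equals that of `W` (`conductorExponent_twistModel`; the exponent is an
isomorphism invariant, `conductorExponent_smul'`). In factorisation currency (`factorization_conductorNorm`).
[cite: SilvermanATAEC1994, IV.9.4 (PDF pp. 344–346)] [cite: SilvermanAEC2009, App. C §16 (PDF pp. 390–391)] -/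
theorem factorization_conductorNorm_quadraticTwist_eq_of_not_dvd {d : ℤ} (hd4 : d % 4 = 1)
    (v : HeightOneSpectrum ℤ) (hvd : ¬ ((natGenerator v : ℕ) : ℤ) ∣ d) :
    (haveI := W.isElliptic_quadraticTwist (show ((d : ℚ)) ≠ 0 by exact_mod_cast (show d ≠ 0 by omega));
      ((W.quadraticTwist (d : ℚ)).conductorNorm ℤ).factorization (natGenerator v)) =
      (W.conductorNorm ℤ).factorization (natGenerator v) := by
  have hd0 : d ≠ 0 := by omega
  have hdq : (d : ℚ) ≠ 0 := by exact_mod_cast hd0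
  haveI := W.isElliptic_quadraticTwist hdq
  set k : ℤ := (d - 1) / 4 with hk
  have hk4 : 4 * k + 1 = d := by omega
  have hkq : 4 * (k : ℚ) + 1 = (d : ℚ) := by exact_mod_cast hk4
  obtain ⟨C, -, hC⟩ := exists_variableChange_twistModel_eq_quadraticTwist W (k : ℚ)
  rw [hkq] at hC
  haveI : (W.twistModel (k : ℚ)).IsElliptic := by
    have h : C⁻¹ • W.quadraticTwist (d : ℚ) = W.twistModel (k : ℚ) := by rw [← hC, inv_smul_smul]
    rw [← h]; infer_instance
  have hfW := factorization_conductorNorm_holds W v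
  have hfA := factorization_conductorNorm_holds (W.quadraticTwist (d : ℚ)) v
  rw [hfW, hfA, ← hC, conductorExponent_smul' v (W.twistModel (k : ℚ)) C]
  refine conductorExponent_twistModel v W ?_ ?_
  · rw [show ((k : ℚ)) = algebraMap ℤ ℚ k from (eq_intCast _ k).symm]
    exact valuation_le_one v k
  · rw [hkq]
    exact valuation_int_intCast_eq_one v hvd

/-- **At a place `q ∣ d` (odd, `q ∥ d`) where `E` is good or multiplicative: `f_q(E) ≤ 1` and `2 ≤ f_q(E^{(d)})`**
(the twist is additive there, §1; `conductorExponent_eq_zero_iff`, `_eq_one_iff`, `two_le_conductorExponent_iff`), in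
factorisation currency, for `W` globally minimal. [cite: SilvermanAEC2009, App. C §16 (PDF pp. 390–391) and VII.5 Prop. 5.1(c)] -/
theorem factorization_conductorNorm_quadraticTwist_of_dvd [W.IsGloballyMinimal] {d : ℤ} (hd4 : d % 4 = 1)
    (hsq : Squarefree d) (v : HeightOneSpectrum ℤ) (hvd : ((natGenerator v : ℕ) : ℤ) ∣ d)
    (hred : ∀ w : HeightOneSpectrum (𝓞 ℚ), ((primesEquiv w : ℕ) : ℤ) ∣ d →
      W.HasGoodReductionAt w ∨ W.HasMultiplicativeReductionAt w) :
    (W.conductorNorm ℤ).factorization (natGenerator v) ≤ 1 ∧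
      (haveI := W.isElliptic_quadraticTwist (show ((d : ℚ)) ≠ 0 by exact_mod_cast (show d ≠ 0 by omega));
        2 ≤ ((W.quadraticTwist (d : ℚ)).conductorNorm ℤ).factorization (natGenerator v)) := by
  have hd0 : d ≠ 0 := by omega
  have hdq : (d : ℚ) ≠ 0 := by exact_mod_cast hd0
  haveI := W.isElliptic_quadraticTwist hdq
  -- the prime `p = ℓ_v`, the `ℤ`-place `v = primesEquiv.symm p` and the `𝓞 ℚ`-place `w` over `p`
  obtain ⟨p, rfl⟩ := (primesEquiv (R := ℤ)).symm.surjective v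
  obtain ⟨w, hw⟩ : ∃ w : HeightOneSpectrum (𝓞 ℚ), primesEquiv w = p :=
    ⟨(primesEquiv (R := 𝓞 ℚ)).symm p, Equiv.apply_symm_apply _ _⟩
  subst hw
  haveI : Fact (primesEquiv w : ℕ).Prime := ⟨(primesEquiv w).2⟩
  have hgen : (natGenerator ((primesEquiv (R := ℤ)).symm (primesEquiv w)) : ℕ) = (primesEquiv w : ℕ) :=
    congrArg (fun q : Nat.Primes ↦ (q : ℕ)) ((primesEquiv (R := ℤ)).apply_symm_apply _)
  have hww : (primesEquiv (R := 𝓞 ℚ)).symm (primesEquiv w) = w := Equiv.symm_apply_apply _ w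
  have hwd : ((primesEquiv w : ℕ) : ℤ) ∣ d := by rw [← hgen]; exact hvd
  have hp2 : (primesEquiv w : ℕ) ≠ 2 := by
    intro h
    have : (2 : ℤ) ∣ d := by rw [h] at hwd; exact_mod_cast hwd
    omega
  have hsq' : ¬ ((primesEquiv w : ℕ) : ℤ) ^ 2 ∣ d := by
    intro h
    have hu := hsq ((primesEquiv w : ℕ) : ℤ) (by rw [← sq]; exact h)
    rw [Int.isUnit_iff_natAbs_eq, Int.natAbs_natCast] at hu
    exact (primesEquiv w).2.one_lt.ne' hu
  -- `E^{(d)}` is additive at `w`, hence at `v`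
  have haddw : (W.quadraticTwist (d : ℚ)).HasAdditiveReductionAt w :=
    W.hasAdditiveReductionAt_quadraticTwist_of_dvd_of_good_or_mult w hp2 hd0 hwd hsq' (hred w hwd)
  have haddv : (W.quadraticTwist (d : ℚ)).HasAdditiveReductionAt ((primesEquiv (R := ℤ)).symm (primesEquiv w)) := by
    have h := (W.quadraticTwist (d : ℚ)).hasAdditiveReductionAt_int_iff_ringOfIntegers (primesEquiv w)
    rw [hww] at h
    exact h.mpr haddw
  have hfA := factorization_conductorNorm_holds (W.quadraticTwist (d : ℚ)) ((primesEquiv (R := ℤ)).symm (primesEquiv w))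
  have hfW := factorization_conductorNorm_holds W ((primesEquiv (R := ℤ)).symm (primesEquiv w))
  refine ⟨?_, ?_⟩
  · rw [hfW]
    rcases hred w hwd with hg | hm
    · have hgp : W.HasGoodReductionAtPrime (primesEquiv w : ℕ) :=
        (hasGoodReductionAtPrime_iff_hasGoodReductionAt_ringOfIntegers w W).mpr hg
      have hgv : W.HasGoodReductionAt ((primesEquiv (R := ℤ)).symm (primesEquiv w)) :=
        (W.hasGoodReductionAtPrime_iff_hasGoodReductionAt_holds (primesEquiv w)).mp hgp
      rw [(conductorExponent_eq_zero_iff_holds _ W).mpr hgv]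
      exact zero_le_one
    · have hmp : W.HasMultiplicativeReductionAtPrime (primesEquiv w : ℕ) :=
        (W.hasMultiplicativeReductionAtPrime_iff_hasMultiplicativeReductionAt_ringOfIntegers w).mpr hm
      have hmv : W.HasMultiplicativeReductionAt ((primesEquiv (R := ℤ)).symm (primesEquiv w)) :=
        (W.hasMultiplicativeReductionAtPrime_iff_hasMultiplicativeReductionAt_holds (primesEquiv w)).mp hmp
      rw [(conductorExponent_eq_one_iff_holds _ W).mpr hmv]
  · rw [hfA]
    exact (two_le_conductorExponent_iff_holds _ (W.quadraticTwist (d : ℚ))).mpr haddv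

/-- **`N_E ∣ N_{E^{(d)}}`, `d² ∣ N_{E^{(d)}}`, and `2 ∤ N_E ⇒ 2 ∤ N_{E^{(d)}}`** for `W` globally minimal, `d ≡ 1 (mod 4)`
square-free, and good or multiplicative reduction of `E` at the primes of `d` (compare the exponents prime by prime:
`factorization_conductorNorm_quadraticTwist_eq_of_not_dvd`, `…_of_dvd`; at `q ∣ d`, `v_q(d²) = 2`). The exact conductor
`N_{E^{(d)}} = N_E d²/gcd(d, N_E)` (Atkin–Lehner–Li) is not needed by the Birch lemma and is not proved here.
[cite: SilvermanAEC2009, App. C §16 (PDF pp. 390–391)] [cite: AtkinLehner1970, §6] -/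
theorem conductorNorm_dvd_and_sq_dvd_conductorNorm_quadraticTwist [W.IsGloballyMinimal] {d : ℤ}
    (hd4 : d % 4 = 1) (hsq : Squarefree d)
    (hred : ∀ w : HeightOneSpectrum (𝓞 ℚ), ((primesEquiv w : ℕ) : ℤ) ∣ d →
      W.HasGoodReductionAt w ∨ W.HasMultiplicativeReductionAt w) :
    (haveI := W.isElliptic_quadraticTwist (show ((d : ℚ)) ≠ 0 by exact_mod_cast (show d ≠ 0 by omega));
      W.conductorNorm ℤ ∣ (W.quadraticTwist (d : ℚ)).conductorNorm ℤ ∧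
        d.natAbs ^ 2 ∣ (W.quadraticTwist (d : ℚ)).conductorNorm ℤ ∧
        (¬ 2 ∣ W.conductorNorm ℤ → ¬ 2 ∣ (W.quadraticTwist (d : ℚ)).conductorNorm ℤ)) := by
  have hd0 : d ≠ 0 := by omega
  have hdq : (d : ℚ) ≠ 0 := by exact_mod_cast hd0
  haveI := W.isElliptic_quadraticTwist hdq
  set N := W.conductorNorm ℤ with hN
  set N' := (W.quadraticTwist (d : ℚ)).conductorNorm ℤ with hN'
  have hN0 : N ≠ 0 := (W.conductorNorm_pos_holds).ne'
  have hN'0 : N' ≠ 0 := ((W.quadraticTwist (d : ℚ)).conductorNorm_pos_holds).ne'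
  have hgen : ∀ q : Nat.Primes, natGenerator ((primesEquiv (R := ℤ)).symm q) = q := fun q ↦
    congrArg (fun q : Nat.Primes ↦ (q : ℕ)) ((primesEquiv (R := ℤ)).apply_symm_apply q)
  -- prime-by-prime comparison
  have hle : ∀ q : ℕ, q.Prime → N.factorization q ≤ N'.factorization q ∧
      (((q : ℤ) ∣ d) → 2 ≤ N'.factorization q) := by
    intro q hq
    set vq : HeightOneSpectrum ℤ := (primesEquiv (R := ℤ)).symm ⟨q, hq⟩ with hvq
    have hgenq : natGenerator vq = q := by rw [hvq]; exact hgen ⟨q, hq⟩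
    by_cases hqd : (q : ℤ) ∣ d
    · obtain ⟨h1, h2⟩ := W.factorization_conductorNorm_quadraticTwist_of_dvd hd4 hsq vq (by rw [hgenq]; exact hqd) hred
      rw [hgenq] at h1 h2
      exact ⟨le_trans h1 (le_trans one_le_two h2), fun _ ↦ h2⟩
    · have h := W.factorization_conductorNorm_quadraticTwist_eq_of_not_dvd hd4 vq (by rw [hgenq]; exact hqd)
      rw [hgenq] at h
      exact ⟨h.symm.le, fun h' ↦ absurd h' hqd⟩
  refine ⟨?_, ?_, ?_⟩
  · refine (Nat.factorization_le_iff_dvd hN0 hN'0).mp (Finsupp.le_def.mpr fun q ↦ ?_)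
    by_cases hq : q.Prime
    · exact (hle q hq).1
    · rw [Nat.factorization_eq_zero_of_not_prime _ hq]; exact Nat.zero_le _
  · have hda : d.natAbs ≠ 0 := Int.natAbs_ne_zero.mpr hd0
    refine (Nat.factorization_le_iff_dvd (pow_ne_zero 2 hda) hN'0).mp (Finsupp.le_def.mpr fun q ↦ ?_)
    rw [Nat.factorization_pow, Finsupp.smul_apply, smul_eq_mul]
    by_cases hq : q.Prime
    · by_cases hqd : (q : ℤ) ∣ d
      · have hsq1 : d.natAbs.factorization q ≤ 1 :=
          Nat.squarefree_iff_factorization_le_one hda |>.mp (Int.squarefree_natAbs.mpr hsq) q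
        calc 2 * d.natAbs.factorization q ≤ 2 * 1 := by gcongr
          _ ≤ N'.factorization q := by rw [mul_one]; exact (hle q hq).2 hqd
      · have h0 : d.natAbs.factorization q = 0 :=
          Nat.factorization_eq_zero_of_not_dvd fun h ↦ hqd (Int.natCast_dvd.mpr h)
        rw [h0, mul_zero]; exact Nat.zero_le _
    · rw [Nat.factorization_eq_zero_of_not_prime _ hq, mul_zero]; exact Nat.zero_le _
  · intro h2N h2N'
    have h2d : ¬ ((2 : ℕ) : ℤ) ∣ d := by intro h; omega
    set v2 : HeightOneSpectrum ℤ := (primesEquiv (R := ℤ)).symm ⟨2, Nat.prime_two⟩ with hv2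
    have hgen2 : natGenerator v2 = 2 := by rw [hv2]; exact hgen ⟨2, Nat.prime_two⟩
    have h := W.factorization_conductorNorm_quadraticTwist_eq_of_not_dvd hd4 v2 (by rw [hgen2]; exact h2d)
    rw [hgen2] at h
    have hpos : 0 < N'.factorization 2 := Nat.Prime.factorization_pos_of_dvd Nat.prime_two hN'0 h2N'
    rw [h] at hpos
    exact h2N (Nat.dvd_of_factorization_pos (Nat.pos_iff_ne_zero.mp hpos))

end Conductor

end WeierstrassCurve

namespace Literature.NumberTheory.EllipticCurves

/-! ### §4. Birch's lemma for the pair `(f_W, f_A)`, `A` a minimal model of `W^{(d)}`, `d` meeting `N_W` at multiplicative primes -/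

section Newform

variable (W : WeierstrassCurve ℚ) [W.IsElliptic] [W.IsGloballyMinimal] {d : ℤ} {A : WeierstrassCurve ℚ} [A.IsElliptic]

omit [A.IsElliptic] in
/-- **`aₙ(A) = χ_d(n)·aₙ(W)`** for a model `A` of `W^{(d)}`, `d ≡ 1 (mod 4)` square-free, `W` good or multiplicative at the
primes of `d` (`LFunction_quadraticTwist_apply_of_isGloballyMinimal_sqfreeAt`; `LFunction_smul`).
[cite: SilvermanAEC2009, X.2 and Exercise 10.16] -/
theorem LFunction_twist_apply_sqfreeAt (hd4 : d % 4 = 1) (hsq : Squarefree d)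
    (hred : ∀ v : HeightOneSpectrum (𝓞 ℚ), ((primesEquiv v : ℕ) : ℤ) ∣ d →
      W.HasGoodReductionAt v ∨ W.HasMultiplicativeReductionAt v)
    {C : VariableChange ℚ} (hA : C • W.quadraticTwist (d : ℚ) = A) (n : ℕ) :
    A.LFunction n = J((n : ℤ) | d.natAbs) * W.LFunction n := by
  have hd0 : (d : ℚ) ≠ 0 := by exact_mod_cast (show d ≠ 0 by rintro rfl; norm_num at hd4)
  haveI := W.isElliptic_quadraticTwist hd0
  rw [← hA, LFunction_smul]
  exact W.LFunction_quadraticTwist_apply_of_isGloballyMinimal_sqfreeAt hd4 hsq hred n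

omit [A.IsElliptic] in
/-- The same in `ℂ` through the Jacobi character `χ` mod `m = |d|`: `aₙ(A) = χ(n)·aₙ(W)`.
[cite: SilvermanAEC2009, X.2 and Exercise 10.16] -/
theorem LFunction_twist_apply_complex_sqfreeAt (hd4 : d % 4 = 1) (hsq : Squarefree d)
    (hred : ∀ v : HeightOneSpectrum (𝓞 ℚ), ((primesEquiv v : ℕ) : ℤ) ∣ d →
      W.HasGoodReductionAt v ∨ W.HasMultiplicativeReductionAt v)
    {C : VariableChange ℚ} (hA : C • W.quadraticTwist (d : ℚ) = A)
    [NeZero d.natAbs] {χ : MulChar (ZMod d.natAbs) ℤ} (hχ : ∀ a : ZMod d.natAbs, χ a = J((a.val : ℤ) | d.natAbs))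
    (n : ℕ) : (A.LFunction n : ℂ) = (χ.ringHomComp (Int.castRingHom ℂ)) n * (W.LFunction n : ℂ) := by
  rw [LFunction_twist_apply_sqfreeAt W hd4 hsq hred hA n, Int.cast_mul, MulChar.ringHomComp_apply,
    mulChar_jacobi_apply_natCast hχ, eq_intCast]

omit [A.IsElliptic] in
/-- **Conductor of the twist: `N_W ∣ N_A`, `d² ∣ N_A`, `2 ∤ N_W ⇒ 2 ∤ N_A`** for a model `A` of `W^{(d)}`
(`conductorNorm_dvd_and_sq_dvd_conductorNorm_quadraticTwist`, `conductorNorm_smul_rat`). [cite: AtkinLehner1970, §6]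
[cite: SilvermanAEC2009, App. C §16 (PDF pp. 390–391)] -/
theorem conductorNorm_twist_dvd_sqfreeAt (hd4 : d % 4 = 1) (hsq : Squarefree d)
    (hred : ∀ v : HeightOneSpectrum (𝓞 ℚ), ((primesEquiv v : ℕ) : ℤ) ∣ d →
      W.HasGoodReductionAt v ∨ W.HasMultiplicativeReductionAt v)
    {C : VariableChange ℚ} (hA : C • W.quadraticTwist (d : ℚ) = A) :
    W.conductorNorm ℤ ∣ A.conductorNorm ℤ ∧ d.natAbs ^ 2 ∣ A.conductorNorm ℤ ∧
      (¬ 2 ∣ W.conductorNorm ℤ → ¬ 2 ∣ A.conductorNorm ℤ) := by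
  have hd0 : (d : ℚ) ≠ 0 := by exact_mod_cast (show d ≠ 0 by rintro rfl; norm_num at hd4)
  haveI := W.isElliptic_quadraticTwist hd0
  have hNA : A.conductorNorm ℤ = (W.quadraticTwist (d : ℚ)).conductorNorm ℤ := by
    rw [← hA]; exact WeierstrassCurve.conductorNorm_smul ℤ _ C
  rw [hNA]
  exact W.conductorNorm_dvd_and_sq_dvd_conductorNorm_quadraticTwist hd4 hsq hred

variable [NeZero (W.conductorNorm ℤ)] [NeZero (A.conductorNorm ℤ)] [NeZero d.natAbs]
  {fW : CuspForm (Gamma0 (W.conductorNorm ℤ)) 2} {fA : CuspForm (Gamma0 (A.conductorNorm ℤ)) 2}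

omit [A.IsElliptic] in
/-- **The newform of the twist is Shimura's twisted form `f_A = (f_W)_χ`** at level `N_A` (for the divisibility witnesses
`N_W ∣ N_A`, `d² ∣ N_A` of `conductorNorm_twist_dvd_sqfreeAt`): both sides have `q`-expansion `Σ χ_d(n) aₙ(W) qⁿ`
(`cuspCoeff_charTwist`, `aₙ(A) = χ_d(n) aₙ(W)`), and a cusp form on `Γ₀(N_A)` is determined by its `q`-expansion.
The companion of `isNewformOf_twist_eq_charTwist` without `(d, N_W) = 1`. [cite: Shimura1971, Prop. 3.64] -/
theorem isNewformOf_twist_eq_charTwist_sqfreeAt (hd4 : d % 4 = 1) (hsq : Squarefree d)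
    (hred : ∀ v : HeightOneSpectrum (𝓞 ℚ), ((primesEquiv v : ℕ) : ℤ) ∣ d →
      W.HasGoodReductionAt v ∨ W.HasMultiplicativeReductionAt v)
    {C : VariableChange ℚ} (hA : C • W.quadraticTwist (d : ℚ) = A)
    (hfW : IsNewformOf W fW) (hfA : IsNewformOf A fA)
    {χ : MulChar (ZMod d.natAbs) ℤ} (hχ : ∀ a : ZMod d.natAbs, χ a = J((a.val : ℤ) | d.natAbs))
    (hq : (χ.ringHomComp (Int.castRingHom ℂ)).IsQuadratic)
    (hprim : DirichletCharacter.IsPrimitive (χ.ringHomComp (Int.castRingHom ℂ)))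
    (hN : W.conductorNorm ℤ ∣ A.conductorNorm ℤ) (hm : d.natAbs ^ 2 ∣ A.conductorNorm ℤ) :
    fA = charTwist (A.conductorNorm ℤ) hN hm hq fW := by
  refine eq_of_forall_cuspCoeff_eq_gamma0 fun n ↦ ?_
  rw [cuspCoeff_charTwist (A.conductorNorm ℤ) hN hm hq hprim fW n, hfA.2 n, hfW.2 n,
    LFunction_twist_apply_complex_sqfreeAt W hd4 hsq hred hA hχ n]

end Newform

/-! ### §5. Birch's lemma at the symbol level and for the transforms -/

section Birch

variable (W : WeierstrassCurve ℚ) [W.IsElliptic] [W.IsGloballyMinimal] {d : ℤ} {A : WeierstrassCurve ℚ} [A.IsElliptic]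
  [NeZero (W.conductorNorm ℤ)] [NeZero (A.conductorNorm ℤ)] [NeZero d.natAbs]
  {fW : CuspForm (Gamma0 (W.conductorNorm ℤ)) 2} {fA : CuspForm (Gamma0 (A.conductorNorm ℤ)) 2}

omit [A.IsElliptic] in
/-- **Birch's lemma for the newforms of `E` and `E^{(d)}` WITHOUT `(d, N_E) = 1`** (`d > 0`, `d ≡ 1 (mod 4)` square-free, `E`
good or multiplicative at the primes of `d`): ONE rational constant `c` with `[x]⁺_{f_A} = c · Σ_{b mod m} χ_d(b) · [x + b/m]⁺_{f_W}`
for every `x ∈ ℚ` (`m = d`; the tree's `exists_rat_forall_ratPlusSymbol_charTwist_eq`, Mazur–Tate–Teitelbaum §I.8, along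
`f_A = charTwist N_A f_W`). [cite: MazurTateTeitelbaum1986Invent, §I.8] [cite: Shimura1971, Prop. 3.64] -/
theorem exists_ratPlusSymbol_twist_eq_sum_sqfreeAt (hd : 0 < d) (hd4 : d % 4 = 1) (hsq : Squarefree d)
    (hred : ∀ v : HeightOneSpectrum (𝓞 ℚ), ((primesEquiv v : ℕ) : ℤ) ∣ d →
      W.HasGoodReductionAt v ∨ W.HasMultiplicativeReductionAt v)
    {C : VariableChange ℚ} (hA : C • W.quadraticTwist (d : ℚ) = A) (hfW : IsNewformOf W fW) (hfA : IsNewformOf A fA)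
    {χ : MulChar (ZMod d.natAbs) ℤ} (hχ : ∀ a : ZMod d.natAbs, χ a = J((a.val : ℤ) | d.natAbs)) :
    ∃ c : ℚ, ∀ x : ℚ, ratPlusSymbol fA x =
      c * ∑ b : ZMod d.natAbs, (χ.ringHomComp (Int.castRingHom ℚ)) b * ratPlusSymbol fW (x + (b.val : ℚ) / d.natAbs) := by
  have hodd : Odd d.natAbs := Int.natAbs_odd.mpr (Int.odd_iff.mpr (by omega))
  have hsq' : Squarefree d.natAbs := Int.squarefree_natAbs.mpr hsq
  have hm4 : d.natAbs % 4 = 1 := by omega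
  obtain ⟨hq, hprim⟩ := mulChar_jacobi_complex_isQuadratic_isPrimitive hχ hodd hsq'
  have heven : DirichletCharacter.Even (χ.ringHomComp (Int.castRingHom ℂ)) := by
    show (χ.ringHomComp (Int.castRingHom ℂ)) (-1) = 1
    rw [MulChar.ringHomComp_apply, mulChar_jacobi_apply_neg_one hχ hm4, map_one]
  obtain ⟨hN, hm, -⟩ := conductorNorm_twist_dvd_sqfreeAt W hd4 hsq hred hA
  have hFA := isNewformOf_twist_eq_charTwist_sqfreeAt W hd4 hsq hred hA hfW hfA hχ hq hprim hN hm
  subst hFA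
  obtain ⟨c, hc, -⟩ := exists_rat_forall_ratPlusSymbol_charTwist_eq (A.conductorNorm ℤ) hN hm hq heven hprim
    hfW.1 hfW.coeffField_eq_bot hfA.1 hfA.coeffField_eq_bot (fun u ↦ J((u.val : ℤ) | d.natAbs))
    (fun u ↦ by rw [MulChar.ringHomComp_apply, hχ, eq_intCast])
  refine ⟨c, fun x ↦ ?_⟩
  rw [hc x]
  congr 1
  refine Finset.sum_congr rfl fun b _ ↦ ?_
  rw [MulChar.ringHomComp_apply, hχ, eq_intCast]
  rfl

variable [A.IsGloballyMinimal] (p : ℕ) [Fact p.Prime]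

omit [NeZero (W.conductorNorm ℤ)] [NeZero (A.conductorNorm ℤ)] [NeZero d.natAbs] in
/-- **`A = E^{(d)}` has good reduction at every good prime `p ∤ d` of `E`, and `a_p(A) = (p / |d|)·a_p(E)`** (`E` good or
multiplicative at the primes of `d`): `f_p(A) = f_p(E) = 0` at `p ∤ d` (`factorization_conductorNorm_quadraticTwist_eq_of_not_dvd`),
so `p ∤ N_A`; the coefficient identity at `n = p`. [cite: SilvermanAEC2009, X.2 and Exercise 10.16] -/
theorem hasGoodReductionAtPrime_twist_and_frobeniusTrace_eq_sqfreeAt (hd4 : d % 4 = 1) (hsq : Squarefree d)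
    (hred : ∀ v : HeightOneSpectrum (𝓞 ℚ), ((primesEquiv v : ℕ) : ℤ) ∣ d →
      W.HasGoodReductionAt v ∨ W.HasMultiplicativeReductionAt v)
    {C : VariableChange ℚ} (hA : C • W.quadraticTwist (d : ℚ) = A) (hgood : W.HasGoodReductionAtPrime p)
    (hpd : ¬ (p : ℤ) ∣ d) :
    A.HasGoodReductionAtPrime p ∧ A.frobeniusTrace p = J((p : ℤ) | d.natAbs) * W.frobeniusTrace p := by
  have hp : p.Prime := Fact.out
  have hd0 : (d : ℚ) ≠ 0 := by exact_mod_cast (show d ≠ 0 by rintro rfl; norm_num at hd4)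
  haveI := W.isElliptic_quadraticTwist hd0
  have hpN : ¬ p ∣ W.conductorNorm ℤ := fun h ↦ (W.dvd_conductorNorm_iff_not_hasGoodReductionAtPrime p).mp h hgood
  set vp : HeightOneSpectrum ℤ := (primesEquiv (R := ℤ)).symm ⟨p, hp⟩ with hvp
  have hgenp : natGenerator vp = p :=
    congrArg (fun q : Nat.Primes ↦ (q : ℕ)) ((primesEquiv (R := ℤ)).apply_symm_apply ⟨p, hp⟩)
  have hfac := W.factorization_conductorNorm_quadraticTwist_eq_of_not_dvd hd4 vp (by rw [hgenp]; exact hpd)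
  rw [hgenp] at hfac
  have hNA : A.conductorNorm ℤ = (W.quadraticTwist (d : ℚ)).conductorNorm ℤ := by
    rw [← hA]; exact WeierstrassCurve.conductorNorm_smul ℤ _ C
  have hpNA : ¬ p ∣ A.conductorNorm ℤ := by
    intro h
    rw [hNA] at h
    have hpos : 0 < ((W.quadraticTwist (d : ℚ)).conductorNorm ℤ).factorization p :=
      Nat.Prime.factorization_pos_of_dvd hp ((W.quadraticTwist (d : ℚ)).conductorNorm_pos_holds).ne' h
    rw [hfac] at hpos
    exact hpN (Nat.dvd_of_factorization_pos (Nat.pos_iff_ne_zero.mp hpos))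
  have hgoodA : A.HasGoodReductionAtPrime p := by
    by_contra h
    exact hpNA ((A.dvd_conductorNorm_iff_not_hasGoodReductionAtPrime p).mpr h)
  refine ⟨hgoodA, ?_⟩
  have h := LFunction_twist_apply_sqfreeAt W hd4 hsq hred hA p
  rwa [LFunction_apply_prime_eq_frobeniusTrace A p hgoodA, LFunction_apply_prime_eq_frobeniusTrace W p hgood] at h

omit [NeZero (W.conductorNorm ℤ)] [NeZero (A.conductorNorm ℤ)] [NeZero d.natAbs] in
/-- **The twist is good ORDINARY at `p`, with unit root `α_A = (p / |d|)·α_W`** (`p ∤ d` a good ordinary prime of `E`; `E` good or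
multiplicative at the primes of `d`). The companion of `isOrdinaryAt_twist_and_unitRoot_eq`.
[cite: MazurTateTeitelbaum1986Invent, §I.11 (allowable root)] -/
theorem isOrdinaryAt_twist_and_unitRoot_eq_sqfreeAt (hd4 : d % 4 = 1) (hsq : Squarefree d)
    (hred : ∀ v : HeightOneSpectrum (𝓞 ℚ), ((primesEquiv v : ℕ) : ℤ) ∣ d →
      W.HasGoodReductionAt v ∨ W.HasMultiplicativeReductionAt v)
    {C : VariableChange ℚ} (hA : C • W.quadraticTwist (d : ℚ) = A) (hord : IsOrdinaryAt W p) (hpd : ¬ (p : ℤ) ∣ d) :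
    IsOrdinaryAt A p ∧ unitRoot A p = (J((p : ℤ) | d.natAbs) : ℤ_[p]) * unitRoot W p := by
  have hp : p.Prime := Fact.out
  obtain ⟨hgoodA, haA⟩ := hasGoodReductionAtPrime_twist_and_frobeniusTrace_eq_sqfreeAt W p hd4 hsq hred hA hord.1 hpd
  set s : ℤ := J((p : ℤ) | d.natAbs) with hs
  have hpm : ¬ p ∣ d.natAbs := fun h ↦ hpd (Int.natCast_dvd.mpr h)
  have hs2 : s ^ 2 = 1 :=
    jacobiSym.sq_one (by rw [Int.gcd_natCast_natCast]; exact (Nat.Prime.coprime_iff_not_dvd hp).mpr hpm)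
  have hordA : IsOrdinaryAt A p := by
    refine ⟨hgoodA, fun h ↦ hord.2 ?_⟩
    rw [haA] at h
    have h' := h.mul_left s
    rwa [← mul_assoc, ← sq, hs2, one_mul] at h'
  refine ⟨hordA, ?_⟩
  have hEU := existsUnique_unitRoot A p hordA
  have hspecA := unitRoot_spec_holds A p hordA
  have hspecW := unitRoot_spec_holds W p hord
  have hs2' : (s : ℤ_[p]) ^ 2 = 1 := by exact_mod_cast hs2
  have hβ : ((s : ℤ_[p]) * unitRoot W p) ^ 2 - (A.frobeniusTrace p : ℤ_[p]) * ((s : ℤ_[p]) * unitRoot W p) + p = 0 ∧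
      IsUnit ((s : ℤ_[p]) * unitRoot W p) := by
    refine ⟨?_, ?_⟩
    · rw [haA]
      push_cast
      linear_combination (unitRoot W p ^ 2 - (W.frobeniusTrace p : ℤ_[p]) * unitRoot W p) * hs2' + hspecW.1
    · exact (isUnit_iff_exists_inv.mpr ⟨(s : ℤ_[p]), by rw [← sq, hs2']⟩).mul hspecW.2
  exact hEU.unique hspecA hβ

/-- **Birch's lemma for the `p`-adic `L`-function of the quadratic twist WITHOUT `(d, N_E) = 1`** (`p` a good ordinary prime of
`E`, `p ∤ d`; `d > 0`, `d ≡ 1 (mod 4)` square-free, `E` good or multiplicative at the primes of `d`; `m = d`, `χ_d = (· / m)`):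
for some `c ∈ ℚˣ`, `L_p(f_A, α_A, T) = C(c) · (1+T)^{−f_m} · L_p(f_W, m, α_W, χ_d, T)` — the tree's
`padicLFunction_twist_eq_of_birch` fed with §5's symbol relation and unit root; `c ≠ 0` by Rohrlich
(`padicLFunction_unitRoot_ne_zero`). The companion of `exists_padicLFunction_twist_eq_C_mul_padicLFunctionTame`.
[cite: MazurTateTeitelbaum1986Invent, §I.8 and §I.11–I.13] [cite: Matsuno2000, §2 (p. 84)] -/
theorem exists_padicLFunction_twist_eq_C_mul_padicLFunctionTame_sqfreeAt (hd : 0 < d) (hd4 : d % 4 = 1)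
    (hsq : Squarefree d)
    (hred : ∀ v : HeightOneSpectrum (𝓞 ℚ), ((primesEquiv v : ℕ) : ℤ) ∣ d →
      W.HasGoodReductionAt v ∨ W.HasMultiplicativeReductionAt v)
    {C : VariableChange ℚ} (hA : C • W.quadraticTwist (d : ℚ) = A) (hfW : IsNewformOf W fW) (hfA : IsNewformOf A fA)
    (hord : IsOrdinaryAt W p) (hpd : ¬ (p : ℤ) ∣ d)
    {χ : MulChar (ZMod d.natAbs) ℤ} (hχ : ∀ a : ZMod d.natAbs, χ a = J((a.val : ℤ) | d.natAbs)) :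
    ∃ c : ℚ, c ≠ 0 ∧ padicLFunction fA (unitRoot A p : ℚ_[p]) =
      PowerSeries.C (c : ℚ_[p]) * PowerSeries.binomialSeries ℚ_[p] (-frobeniusExponent p (d.natAbs : ℤ_[p])) *
        padicLFunctionTame fW d.natAbs (unitRoot W p : ℚ_[p])
          ((χ.ringHomComp (Int.castRingHom ℚ)).ringHomComp (Rat.castHom ℚ_[p])) := by
  have hp : p.Prime := Fact.out
  obtain ⟨c, hB⟩ := exists_ratPlusSymbol_twist_eq_sum_sqfreeAt W hd hd4 hsq hred hA hfW hfA hχ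
  obtain ⟨hordA, hαA⟩ := isOrdinaryAt_twist_and_unitRoot_eq_sqfreeAt W p hd4 hsq hred hA hord hpd
  obtain ⟨hαeq, hαu, -⟩ := unitRoot_coe_spec (W := W) hord
  have hpN : ¬ p ∣ W.conductorNorm ℤ := not_dvd_level_of_isNewformOf hfW hord.1
  have hpm : ¬ p ∣ d.natAbs := fun h ↦ hpd (Int.natCast_dvd.mpr h)
  have hmp : d.natAbs.Coprime p := Nat.coprime_comm.mp ((Nat.Prime.coprime_iff_not_dvd hp).mpr hpm)
  have hap : cuspCoeff fW p = ((W.frobeniusTrace p : ℤ) : ℂ) :=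
    cuspCoeff_eq_frobeniusTrace_of_isNewformOf_holds hfW hord.1
  have hχp : (χ.ringHomComp (Int.castRingHom ℚ)) (p : ZMod d.natAbs) ^ 2 = 1 := by
    rw [MulChar.ringHomComp_apply, ← map_pow, mulChar_jacobi_apply_natCast_sq hχ p hmp.symm, map_one]
  have key := padicLFunction_twist_eq_of_birch fW fA hfW.1 hfW.coeffField_eq_bot hpN hmp hap hαeq hαu
    (χ.ringHomComp (Int.castRingHom ℚ)) hχp hB
  have hαA' : (unitRoot A p : ℚ_[p]) =
      (((χ.ringHomComp (Int.castRingHom ℚ)) (p : ZMod d.natAbs) : ℚ) : ℚ_[p]) * (unitRoot W p : ℚ_[p]) := by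
    rw [hαA, MulChar.ringHomComp_apply, mulChar_jacobi_apply_natCast hχ p, eq_intCast]
    push_cast
    rfl
  refine ⟨c, ?_, by rw [hαA']; exact key⟩
  rintro rfl
  have h0 := padicLFunction_unitRoot_ne_zero hordA hfA
  rw [hαA', key, Rat.cast_zero, map_zero, zero_mul, zero_mul] at h0
  exact h0 rfl

end Birch

end Literature.NumberTheory.EllipticCurves

end
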